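/-
Copyright (c) 2026 the pub-hodgecm-mathlib formalisation cell (harness21).  Prover seat hodgecm-mathlib-K2Liu-p01 (g7), Track B «K2-LIT»,
#184♮ = hLiu418 = `stmt-HodgeConjecture-24832`; LEAD F0P6-plan (g13) DEAL 2026-09-04T10:11:36Z (2) (S1-F5), my census 10:19:03Z (Route A, file F5b).
#42S payer road, organ S1 (ROAD W, «M-157t»), file F5b.
-/
import Literature.NumberTheory.Weil1964.LocalWeilIndexHermitianRes   -- ★ `resQF`, `hermSesq`, `coordEquiv`, `normFormIndex`, `weilIndexSpace_resQF` (non-degenerate case)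
import HarnessLib

/-!
# Crux `HLiu418`, #42S organ S1 (ROAD W), file F5b: THE WEIL INDEX OF THE RESTRICTION OF SCALARS OF A POSSIBLY DEGENERATE HERMITIAN FORM —
# `γ_ψ(Res h_H) = (d, ∏_{aᵢ ≠ 0} aᵢ)_v · (γ⁰_d)^{#{i : aᵢ ≠ 0}}` for any diagonalisation `ᵗ(σP) H P = diag(a)`, `P` invertible

Cell `hodgecm-mathlib`, crux item hLiu418 = `stmt-HodgeConjecture-24832` (helper lane `--supports … --as helper`, count-neutral).  THEOREMS ONLY (no `def`, no instance,
no notation, no named-fact hypothesis, no `sorry`).  Sequel of ★ `Literature/NumberTheory/Weil1964/LocalWeilIndexHermitianRes` (`weilIndexSpace_resQF`: the NON-DEGENERATE case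
`γ(Res h_H) = (d, det H)_v·(γ⁰_d)^r`), in the same setting: `k = K_v`, `S` a field with quadratic coordinates `Ψ(a,b) = a + bδ`, `δ² = d ≠ 0`, involution `σ` (`σδ = −δ`).

WHY (census 10:19:03Z, Route A for S1-F5 `K2LiuLocalSWRelativeWeilIndex`): Kudla's splitting at the MIDDLE Weyl element is reached from big-cell data by
`β(w₁) = c(ιa, ιw₁)·β(a w₁)∕β(a)` with `a, a w₁ ∈ Ω_H`, and ★ `localLeray_val_eq_weilIndex_resQF` (whose second argument is arbitrary) gives `c(ιa, ιw₁) = γ_{ψ′}(Res H(a, w₁))`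
with `H(a, w₁)` a DEGENERATE hermitian matrix (rank drop = the rank defect of `C_{w₁}`).  Its index is the index of its non-degenerate part ([Rangarao1993, App. Thm A.3]: radical
directions do not contribute; ★ `weilIndexDiag` is the product over the SUPPORT of the coefficients), so the non-degenerate formula needs its degenerate twin:
* §1 bookkeeping: `hermForm` along the columns of a matrix (`hermForm_col_col`), the norm form `σz·z = re z² − d·im z²`, real values of `σ`-fixed elements; the finite Hilbert-symbol
  product over a finset (`prod_hilbertSymbol_filter`).
* §2 **`weilIndexDiag_diagHermCoeff`** — for ARBITRARY `a : Fin r → K_v` (zeros allowed): `weilIndexDiag (diagHermCoeff a d) = ∏_{i : aᵢ ≠ 0} γ(aᵢ)γ(−d aᵢ) =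
  (d, ∏_{aᵢ≠0} aᵢ)_v · (γ⁰_d)^{#supp a}` (the support of `diagHermCoeff a d` is `supp a × Fin 2`).
* §3 **`weilIndexSpace_resQF_of_diag`** — THE FORMULA: `ᵗ(σP)·H·P = diag(algebraMap ∘ a)` with `IsUnit P.det` ⇒ `γ_ψ(Res h_H) = (d, ∏_{aᵢ≠0} aᵢ)_v·(γ⁰_d)^{#{aᵢ≠0}}`; corollaries
  `…_of_diag_of_forall_ne_zero` (all `aᵢ ≠ 0`: `(d, ∏ aᵢ)·γ⁰^r`, no determinant bookkeeping) and **`weilIndexSpace_resQF_diagonal`** (`H = diag(a)` itself, `P = 1`).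
[Rangarao1993, Appendix Thm A.2–A.3] [HarrisKudlaSweet1996, §1 (1.16)] [Kudla1994, Thm 3.1].
HONEST LABEL.  Count-neutral helper; `HC_CM` is proved only modulo the 7 printed citations (2 remaining named inputs: hLiu418 = `stmt-HodgeConjecture-24832`,
h413 = `stmt-HodgeConjecture-24833`) until rung 0 closes.

## References
* [Rangarao1993] R. Ranga Rao, *On some explicit formulas in the theory of Weil representation*, Pacific J. Math. 157 (1993), Appendix Thm A.2 (3), Thm A.3 (p. 366–367).
* [HarrisKudlaSweet1996] M. Harris, S. S. Kudla, W. J. Sweet, J. Amer. Math. Soc. 9 (1996), §1 (1.16).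
* [Kudla1994] S. S. Kudla, Israel J. Math. 87 (1994), Thm 3.1.
-/

set_option autoImplicit false
set_option linter.dupNamespace false -- the mandated namespace repeats `HodgeConjecture.HodgeConjecture`

noncomputable section

open scoped Classical
open NumberField IsDedekindDomain MeasureTheory Matrix Module
open Literature.NumberTheory.Automorphic.UnitaryGroup
open Literature.NumberTheory.Automorphic.UnitaryGroup.QuadraticCoordinates
open Literature.NumberTheory.QuadraticForms
open Literature.LinearAlgebra.Semilinear
open Literature.NumberTheory.Weil1964

namespace Summit.HodgeConjecture.HodgeConjecture.Cruxes.HLiu418.K2LiuWeilIndexResHermitianDegenerate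

/-! ## §1 Bookkeeping -/

section Sesq

variable {S : Type*} [CommRing S] (σ : S →+* S) {n : Type*} [Fintype n]

/-- `h(Pᵢ, Pⱼ) = (ᵗ(σP)·H·P) i j` for the columns `Pᵢ = (c ↦ P c i)` of a matrix `P`. [folklore] -/
theorem hermForm_col_col {m : Type*} [Fintype m] (H : Matrix n n S) (P : Matrix n m S) (i j : m) :
    hermForm σ H (fun c => P c i) (fun c => P c j) = ((P.map σ)ᵀ * H * P) i j := by
  simp only [hermForm, dotProduct, mulVec, Function.comp_apply, Matrix.mul_apply, Matrix.transpose_apply, Matrix.map_apply,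
    Finset.mul_sum, Finset.sum_mul]
  rw [Finset.sum_comm]
  exact Finset.sum_congr rfl fun a _ => Finset.sum_congr rfl fun b _ => by ring

end Sesq

section Coord

variable {k : Type*} [Field k] {S : Type*} [CommRing S] [Algebra k S] {Ψ : (k × k) ≃+ S} {δ : S} {d : k}
  (h : IsQuadraticCoordinates (algebraMap k S) Ψ δ d) {σ : S →+* S}
  (hσφ : ∀ a, σ (algebraMap k S a) = algebraMap k S a) (hσδ : σ δ = -δ)

include h hσφ hσδ in
/-- the norm form: `σ(z)·z = (re z)² − d (im z)²`. [folklore] -/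
theorem conj_mul_self_eq (z : S) : σ z * z = algebraMap k S (re Ψ z ^ 2 - d * im Ψ z ^ 2) := by
  rw [← h.re_add_im (σ z * z), h.re_mul, h.im_mul, h.re_conj hσφ hσδ, h.im_conj hσφ hσδ]
  have e : re Ψ z * im Ψ z + -im Ψ z * re Ψ z = 0 := by ring
  rw [e, map_zero, zero_mul, add_zero]
  congr 1
  ring

end Coord

section Hilbert

variable (K : Type) [Field K] [NumberField K] (v : HeightOneSpectrum (𝓞 K))

/-- **`∏_{i∈s} (d, aᵢ)_v = (d, ∏_{i∈s} aᵢ)_v`** over a finset on which all `aᵢ ≠ 0` (multiplicativity of the local Hilbert symbol in the second variable, ★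
`hilbertSymbol_adicCompletion_mul_right`). [cite: Omeara1963, §63B] -/
theorem prod_hilbertSymbol_filter {ι : Type*} (s : Finset ι) (a : ι → v.adicCompletion K) (ha : ∀ i ∈ s, a i ≠ 0) {d : v.adicCompletion K} (hd : d ≠ 0) :
    ∏ i ∈ s, (hilbertSymbol (v.adicCompletion K) d (a i) : ℂ) = (hilbertSymbol (v.adicCompletion K) d (∏ i ∈ s, a i) : ℂ) := by
  classical
  induction s using Finset.induction_on with
  | empty =>
    rw [Finset.prod_empty, Finset.prod_empty, hilbertSymbol_one_right]
    norm_num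
  | insert i s hi ih =>
    have ha' : ∀ j ∈ s, a j ≠ 0 := fun j hj => ha j (Finset.mem_insert_of_mem hj)
    have hprod : ∏ j ∈ s, a j ≠ 0 := Finset.prod_ne_zero_iff.2 ha'
    rw [Finset.prod_insert hi, Finset.prod_insert hi, ih ha', hilbertSymbol_adicCompletion_mul_right K v (ha i (Finset.mem_insert_self i s)) hprod hd]
    push_cast
    ring

end Hilbert

/-! ## §2 The diagonal index with zeros allowed -/

section Diag

variable (K : Type) [Field K] [NumberField K] (v : HeightOneSpectrum (𝓞 K))
variable [MeasurableSpace (v.adicCompletion K)] [BorelSpace (v.adicCompletion K)]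
  (μ : Measure (v.adicCompletion K)) [μ.IsAddHaarMeasure] {ψ : AddChar (v.adicCompletion K) Circle}

omit [MeasurableSpace (v.adicCompletion K)] [BorelSpace (v.adicCompletion K)] in
/-- the support of `diagHermCoeff a d` (`(i,0) ↦ aᵢ`, `(i,1) ↦ −d aᵢ`) is `{aᵢ ≠ 0} × Fin 2` (`d ≠ 0`). [folklore] -/
theorem diagHermCoeff_ne_zero_iff {r : ℕ} (a : Fin r → v.adicCompletion K) {d : v.adicCompletion K} (hd : d ≠ 0) (p : Fin r × Fin 2) :
    diagHermCoeff K v a d p ≠ 0 ↔ a p.1 ≠ 0 := by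
  obtain ⟨i, t⟩ := p
  fin_cases t
  · simp [diagHermCoeff, scaledNormCoeff]
  · simp [diagHermCoeff, scaledNormCoeff, hd]

omit [BorelSpace (v.adicCompletion K)] [μ.IsAddHaarMeasure] in
/-- **THE DIAGONAL INDEX WITH ZEROS ALLOWED**: `weilIndexDiag (diagHermCoeff a d) = ∏_{i : aᵢ ≠ 0} γ(aᵢ)·γ(−d aᵢ)`.
[cite: Rangarao1993, Appendix Thm A.3, p. 367] -/
theorem weilIndexDiag_diagHermCoeff_eq_prod_filter {r : ℕ} (a : Fin r → v.adicCompletion K) {d : v.adicCompletion K} (hd : d ≠ 0) :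
    weilIndexDiag ψ μ (diagHermCoeff K v a d) =
      ∏ i ∈ Finset.univ.filter (fun i => a i ≠ 0), (weilIndex ψ μ (a i) * weilIndex ψ μ (-(d * a i))) := by
  classical
  rw [weilIndexDiag_def]
  -- `coeffSupport (diagHermCoeff a d) ≃ {i // aᵢ ≠ 0} × Fin 2`
  let e : coeffSupport (diagHermCoeff K v a d) ≃ {i : Fin r // a i ≠ 0} × Fin 2 :=
    { toFun := fun p => (⟨p.1.1, (diagHermCoeff_ne_zero_iff K v a hd p.1).1 p.2⟩, p.1.2)
      invFun := fun q => ⟨(q.1.1, q.2), (diagHermCoeff_ne_zero_iff K v a hd (q.1.1, q.2)).2 q.1.2⟩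
      left_inv := fun p => by rfl
      right_inv := fun q => by rfl }
  rw [Fintype.prod_equiv e (fun p => weilIndex ψ μ (diagHermCoeff K v a d p))
    (fun q => weilIndex ψ μ (diagHermCoeff K v a d (q.1.1, q.2))) (fun p => rfl), Fintype.prod_prod_type]
  simp only [Fin.prod_univ_two]
  rw [← Finset.prod_subtype (Finset.univ.filter fun i => a i ≠ 0) (p := fun i => a i ≠ 0) (by simp)
    (f := fun i => weilIndex ψ μ (diagHermCoeff K v a d (i, 0)) * weilIndex ψ μ (diagHermCoeff K v a d (i, 1)))]
  refine Finset.prod_congr rfl fun i _ => ?_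
  simp [diagHermCoeff, scaledNormCoeff]

/-- **… `= (d, ∏_{aᵢ≠0} aᵢ)_v · (γ⁰_d)^{#{aᵢ≠0}}`** (★ `weilIndex_mul_weilIndex_neg_mul_eq`: `γ(a)γ(−da) = (d,a)_v·γ⁰_d` for `a ≠ 0`).
[cite: Rangarao1993, Appendix Thm A.3, p. 367] [cite: HarrisKudlaSweet1996, §1 (1.16)] -/
theorem weilIndexDiag_diagHermCoeff (hψ : ψ.IsContinuousNontrivial) {r : ℕ} (a : Fin r → v.adicCompletion K) {d : v.adicCompletion K} (hd : d ≠ 0) :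
    weilIndexDiag ψ μ (diagHermCoeff K v a d) =
      (hilbertSymbol (v.adicCompletion K) d (∏ i ∈ Finset.univ.filter (fun i => a i ≠ 0), a i) : ℂ) *
        normFormIndex K v ψ μ d ^ (Finset.univ.filter (fun i => a i ≠ 0)).card := by
  rw [weilIndexDiag_diagHermCoeff_eq_prod_filter K v μ a hd]
  have hne : ∀ i ∈ Finset.univ.filter (fun i => a i ≠ 0), a i ≠ 0 := fun i hi => (Finset.mem_filter.1 hi).2
  rw [Finset.prod_congr rfl fun i hi => weilIndex_mul_weilIndex_neg_mul_eq K v μ hψ (hne i hi) hd, Finset.prod_mul_distrib,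
    prod_hilbertSymbol_filter K v _ a hne hd, Finset.prod_const]

end Diag

/-! ## §3 The formula for a diagonalised, possibly degenerate hermitian matrix -/

section Formula

variable (K : Type) [Field K] [NumberField K] (v : HeightOneSpectrum (𝓞 K))
variable [MeasurableSpace (v.adicCompletion K)] [BorelSpace (v.adicCompletion K)]
  (μ : Measure (v.adicCompletion K)) [μ.IsAddHaarMeasure] {ψ : AddChar (v.adicCompletion K) Circle}
variable {S : Type*} [Field S] [Algebra (v.adicCompletion K) S] [FiniteDimensional (v.adicCompletion K) S]
  {Ψ : (v.adicCompletion K × v.adicCompletion K) ≃+ S} {δ : S} {d : v.adicCompletion K}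
  (h : IsQuadraticCoordinates (algebraMap (v.adicCompletion K) S) Ψ δ d) {σ : S →+* S}
  (hσφ : ∀ a, σ (algebraMap (v.adicCompletion K) S a) = algebraMap (v.adicCompletion K) S a) (hσδ : σ δ = -δ)

include hσδ in
/-- **THE WEIL INDEX OF `Res h_H` FROM A DIAGONALISATION, ZEROS ALLOWED**: if `ᵗ(σP)·H·P = diag(algebraMap ∘ a)` with `P` invertible (`H`, `P ∈ M_r(S)`,
`a : Fin r → K_v`, some `aᵢ` possibly `0`), then `γ_ψ(Res h_H) = (d, ∏_{aᵢ≠0} aᵢ)_v · (γ⁰_d)^{#{i : aᵢ ≠ 0}}` — the index of the non-degenerate part.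
[cite: Rangarao1993, Appendix Thm A.3, p. 367] [cite: HarrisKudlaSweet1996, §1 (1.16)] -/
theorem weilIndexSpace_resQF_of_diag (hψ : ψ.IsContinuousNontrivial) (hd : d ≠ 0) {r : ℕ}
    (H P : Matrix (Fin r) (Fin r) S) (hP : IsUnit P.det) (a : Fin r → v.adicCompletion K)
    (hD : (P.map σ)ᵀ * H * P = Matrix.diagonal fun i => algebraMap (v.adicCompletion K) S (a i)) :
    weilIndexSpace ψ μ (resQF h σ hσφ H) =
      (hilbertSymbol (v.adicCompletion K) d (∏ i ∈ Finset.univ.filter (fun i => a i ≠ 0), a i) : ℂ) *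
        normFormIndex K v ψ μ d ^ (Finset.univ.filter (fun i => a i ≠ 0)).card := by
  -- §a the basis of columns of `P`
  haveI : Invertible P := Matrix.invertibleOfIsUnitDet P hP
  let eP : (Fin r → S) ≃ₗ[S] (Fin r → S) := Matrix.toLinearEquiv' P ‹Invertible P›
  let b : Basis (Fin r) S (Fin r → S) := (Pi.basisFun S (Fin r)).map eP
  have hb : ∀ i, (b i : Fin r → S) = fun c => P c i := fun i => by
    funext c
    show (Matrix.toLin' P (Pi.basisFun S (Fin r) i)) c = P c i
    rw [Pi.basisFun_apply, Matrix.toLin'_apply, Matrix.mulVec, dotProduct]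
    simp only [Pi.single_apply, mul_ite, mul_one, mul_zero, Finset.sum_ite_eq', Finset.mem_univ, if_true]
  have hB : ∀ i j, hermForm σ H (b i) (b j) = if i = j then algebraMap _ S (a i) else 0 := fun i j => by
    rw [hb i, hb j, hermForm_col_col σ H P i j, hD, Matrix.diagonal_apply]
  -- §b `Res h ∘ (coordinates in b) = ⊕ᵢ aᵢ (x² − d y²)`
  let c : Fin r × Fin 2 → v.adicCompletion K := diagHermCoeff K v a d
  let eqv : (Fin r × Fin 2 → v.adicCompletion K) ≃ₗ[v.adicCompletion K] (Fin r → S) :=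
    (coordEquiv h (Fin r)).trans (b.equivFun.symm.restrictScalars (v.adicCompletion K))
  have hcomp : ∀ u, resQF h σ hσφ H (eqv u) = QuadraticMap.weightedSumSquares (v.adicCompletion K) c u := by
    intro u
    have hx : eqv u = ∑ i, (Ψ (u (i, 0), u (i, 1))) • b i := by
      change b.equivFun.symm (coordEquiv h (Fin r) u) = _
      rw [Basis.equivFun_symm_apply]
      rfl
    -- the value of the hermitian form on `x = Σ zᵢ bᵢ`: `Σ σ(zᵢ) zᵢ aᵢ`
    have happ : ∀ x y, hermSesq σ H x y = hermForm σ H x y := fun _ _ => rfl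
    have hB' : ∀ i j, hermSesq σ H (b i) (b j) = if i = j then algebraMap _ S (a i) else 0 := fun i j => by rw [happ, hB]
    have hval : hermSesq σ H (∑ i, Ψ (u (i, 0), u (i, 1)) • (b i : Fin r → S)) (∑ i, Ψ (u (i, 0), u (i, 1)) • (b i : Fin r → S)) =
        ∑ i, σ (Ψ (u (i, 0), u (i, 1))) * Ψ (u (i, 0), u (i, 1)) * algebraMap (v.adicCompletion K) S (a i) := by
      rw [LinearMap.map_sum₂]
      refine Finset.sum_congr rfl fun i _ => ?_
      rw [LinearMap.map_smulₛₗ₂, map_sum]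
      simp only [map_smul, smul_eq_mul, hB', mul_ite, mul_zero, Finset.sum_ite_eq, Finset.mem_univ, if_true]
      ring
    rw [resQF_apply, hx, ← happ, hval, map_sum, QuadraticMap.weightedSumSquares_apply, Fintype.sum_prod_type]
    refine Finset.sum_congr rfl fun i _ => ?_
    rw [Fin.sum_univ_two, conj_mul_self_eq h hσφ hσδ, ← map_mul, h.re_map]
    have e0 : re Ψ (Ψ (u (i, 0), u (i, 1))) = u (i, 0) := re_apply Ψ _ _
    have e1 : im Ψ (Ψ (u (i, 0), u (i, 1))) = u (i, 1) := im_apply Ψ _ _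
    rw [e0, e1]
    simp only [c, diagHermCoeff, scaledNormCoeff, Matrix.cons_val_zero, Matrix.cons_val_one, smul_eq_mul]
    ring
  have hcomp' : ∀ u, ((resQF h σ hσφ H).comp (eqv : _ →ₗ[v.adicCompletion K] (Fin r → S))) u =
      QuadraticMap.weightedSumSquares (v.adicCompletion K) c
        ((LinearEquiv.refl (v.adicCompletion K) (Fin r × Fin 2 → v.adicCompletion K)) u) := fun u => by
    rw [QuadraticMap.comp_apply, LinearEquiv.coe_coe, LinearEquiv.refl_apply]
    exact hcomp u
  -- §c assemble with the degenerate diagonal index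
  rw [← weilIndexSpace_comp_linearEquiv μ hψ (resQF h σ hσφ H) eqv, weilIndexSpace_eq_weilIndexQF' μ hψ,
    weilIndexQF'_eq_weilIndexDiag μ hψ hcomp']
  exact weilIndexDiag_diagHermCoeff K v μ hψ a hd

include hσδ in
/-- the non-degenerate diagonalised case as a corollary: all `aᵢ ≠ 0` ⇒ `γ_ψ(Res h_H) = (d, ∏ᵢ aᵢ)_v · (γ⁰_d)^r` (no determinant bookkeeping).
[cite: HarrisKudlaSweet1996, §1 (1.16)] -/
theorem weilIndexSpace_resQF_of_diag_of_forall_ne_zero (hψ : ψ.IsContinuousNontrivial) (hd : d ≠ 0) {r : ℕ}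
    (H P : Matrix (Fin r) (Fin r) S) (hP : IsUnit P.det) (a : Fin r → v.adicCompletion K) (ha : ∀ i, a i ≠ 0)
    (hD : (P.map σ)ᵀ * H * P = Matrix.diagonal fun i => algebraMap (v.adicCompletion K) S (a i)) :
    weilIndexSpace ψ μ (resQF h σ hσφ H) = (hilbertSymbol (v.adicCompletion K) d (∏ i, a i) : ℂ) * normFormIndex K v ψ μ d ^ r := by
  rw [weilIndexSpace_resQF_of_diag K v μ h hσφ hσδ hψ hd H P hP a hD]
  have hs : Finset.univ.filter (fun i => a i ≠ 0) = (Finset.univ : Finset (Fin r)) := Finset.filter_true_of_mem fun i _ => ha i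
  rw [hs, Finset.card_univ, Fintype.card_fin]

include hσδ in
/-- **THE DIAGONAL HERMITIAN MATRIX ITSELF**: `γ_ψ(Res h_{diag(a)}) = (d, ∏_{aᵢ≠0} aᵢ)_v · (γ⁰_d)^{#{aᵢ≠0}}` (`P = 1`).
[cite: Rangarao1993, Appendix Thm A.3, p. 367] [cite: HarrisKudlaSweet1996, §1 (1.16)] -/
theorem weilIndexSpace_resQF_diagonal (hψ : ψ.IsContinuousNontrivial) (hd : d ≠ 0) {r : ℕ} (a : Fin r → v.adicCompletion K) :
    weilIndexSpace ψ μ (resQF h σ hσφ (Matrix.diagonal fun i => algebraMap (v.adicCompletion K) S (a i))) =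
      (hilbertSymbol (v.adicCompletion K) d (∏ i ∈ Finset.univ.filter (fun i => a i ≠ 0), a i) : ℂ) *
        normFormIndex K v ψ μ d ^ (Finset.univ.filter (fun i => a i ≠ 0)).card := by
  refine weilIndexSpace_resQF_of_diag K v μ h hσφ hσδ hψ hd _ 1 (by rw [Matrix.det_one]; exact isUnit_one) a ?_
  rw [Matrix.map_one σ (map_zero σ) (map_one σ), Matrix.transpose_one, Matrix.one_mul, Matrix.mul_one]

end Formula

end Summit.HodgeConjecture.HodgeConjecture.Cruxes.HLiu418.K2LiuWeilIndexResHermitianDegenerate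

end
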